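import Literature.NumberTheory.EllipticCurves.Fisher2012.HesseFamilyThreeCongruenceProofs
import Summits.BirchSwinnertonDyer.Rank1Residual.X1.CongruenceTransfer
import Summits.BirchSwinnertonDyer.Rank1Residual.Additive.IntModelTamagawaCertificate
import HarnessLib

/-!
# Hesse-pencil `3`-congruence certificates for LITERAL equations — the two generic lemmas behind every
# C-VIS `θ` record of ROW T-VIS3-TH (one `exact` + seven `norm_num` side goals per pair)
# (cell `b2b-bsdres`, team n1011, ROW T-VIS3-TH FILE 0; seat p07 (gen 10); skeleton cells/n1011/skel/T-VIS3-TH.md)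

HONEST FRAMING (cell `b2b-bsdres`, run/shared/lean/b2b/bsd-rank1-residual/, verbatim in every
file): the goal of the cell is to DELETE the COMBINATION-SHAPED residual classes of the
Birch–Swinnerton-Dyer formula for ALL analytic-rank `≤ 1` elliptic curves over `ℚ` — "full BSD
formula for every rank `≤ 1` curve in class `C`" assembled STRICTLY from published theorems — so
that the rank-`≤ 1` remainder becomes exactly the CONSTRUCTION-SHAPED classes, which are TYPED
(missing-input `Prop`s), NOT attempted. This is not "finishing BSD". Team n1011 (N11 = X4 ∧ `p = 3`):
research route; TOOL lemmas only — NO definition, NO new named fact, NO `sorry`; nothing booked; no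
mark / label / count moved; closes nothing.

## What

The tree's certificate corollaries of Fisher's Theorem 13.2 (`n = 3`) —
`Fisher2012.threeCongruent_of_hesseCertificate_unconditional` (DIRECT pencil `X_E(3)`; the named fact
is the THEOREM `thm132_threeCongruent_hessePencil_holds`, n1011-p02 T-F132-3) and
`Fisher2012.threeCongruent_of_dualHesseCertificate` (DUAL pencil `X_E^-(3)`, modulo the registered
fact `thm132rev_threeCongruent_dualHessePencil` = A243) — take the hypotheses
`𝔠₄(l,m) = u⁴·c₄(G)`, `𝔠₆(l,m) = u⁶·c₆(G)` with `MvPolynomial.eval` on the left and the curves'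
`c₄, c₆` on the right. For RECORD files over hundreds of literal equations `[a₁,…,a₆]` this file
packages the bookkeeping once: `c₄_mk`, `c₆_mk` (the invariants of a literal equation as ring
expressions in the coefficients) and **`torsionIso3_of_hesseCert_mk`** / **`torsionIso3_of_dualHesseCert_mk`**
— inputs: the two literal equations (`hW : W = ⟨…⟩`, `hW' : W' = ⟨…⟩`), the four invariants as
numerals with their four defining identities, the certificate `(l, m, u)`, `u ≠ 0`, and Fisher's two
identities in CLOSED FORM (`eval_hesseC4three / eval_hesseC6three / eval_hesseD3`, PROVED in the
tree); output `TorsionIso W' W 3` (`Γ_ℚ`-isomorphism `W'[3] ≅ W[3]`). Every hypothesis of a record is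
then a numeral identity closed by `norm_num`. Consumers: `GaloisImage/ThreeCongruenceHesseCertificates{V40A–E, Batch2, …}.lean`.

References: T. Fisher, *The Hessian of a genus one curve*, Proc. LMS 104 (2012) 613–648, Thm. 13.2,
§8, §13 [Fisher2012Hessian]; J. H. Silverman, *AEC* (2009) III §1 [SilvermanAEC2009].
-/

set_option autoImplicit false

open MvPolynomial WeierstrassCurve
open Literature.NumberTheory.EllipticCurves Literature.NumberTheory.EllipticCurves.Fisher2012
open Summit.BirchSwinnertonDyer.Rank1Residual.X1.CongruenceTransfer

namespace Summit.BirchSwinnertonDyer.Rank1Residual.GaloisImage.VisCerts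

/-- `c₄` of a literal Weierstrass equation in terms of its coefficients
(`c₄ = b₂² − 24 b₄`, `b₂ = a₁² + 4a₂`, `b₄ = 2a₄ + a₁a₃`). [cite: SilvermanAEC2009, III §1 (b₂, b₄, c₄)] -/
theorem c₄_mk (a₁ a₂ a₃ a₄ a₆ : ℚ) :
    (⟨a₁, a₂, a₃, a₄, a₆⟩ : WeierstrassCurve ℚ).c₄ = (a₁ ^ 2 + 4 * a₂) ^ 2 - 24 * (2 * a₄ + a₁ * a₃) := by
  simp only [WeierstrassCurve.c₄, WeierstrassCurve.b₂, WeierstrassCurve.b₄]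

/-- `c₆` of a literal Weierstrass equation in terms of its coefficients
(`c₆ = −b₂³ + 36 b₂b₄ − 216 b₆`, `b₆ = a₃² + 4a₆`). [cite: SilvermanAEC2009, III §1 (b₂, b₄, b₆, c₆)] -/
theorem c₆_mk (a₁ a₂ a₃ a₄ a₆ : ℚ) :
    (⟨a₁, a₂, a₃, a₄, a₆⟩ : WeierstrassCurve ℚ).c₆ =
      -(a₁ ^ 2 + 4 * a₂) ^ 3 + 36 * (a₁ ^ 2 + 4 * a₂) * (2 * a₄ + a₁ * a₃) - 216 * (a₃ ^ 2 + 4 * a₆) := by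
  simp only [WeierstrassCurve.c₆, WeierstrassCurve.b₂, WeierstrassCurve.b₄, WeierstrassCurve.b₆]

/-- **Direct Hesse certificate for literal equations** (UNCONDITIONAL: Fisher 2012 Thm. 13.2, `n = 3`,
is the tree theorem `thm132_threeCongruent_hessePencil_holds`): for elliptic `W = [a₁,…,a₆]`,
`W' = [a₁',…,a₆']` with invariants `c₄, c₆, c₄', c₆'` (four ring identities in the coefficients) and
`l m u : ℚ`, `u ≠ 0`, the two CLOSED-FORM identities `𝔠₄(l,m) = u⁴c₄'`, `𝔠₆(l,m) = u⁶c₆'`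
(`Fisher2012.eval_hesseC4three / eval_hesseC6three`) give `TorsionIso W' W 3` (`Γ_ℚ`-iso
`W'[3] ≅ W[3]`). Every hypothesis is a numeral identity closed by `norm_num` per record.
[cite: Fisher2012Hessian, Thm. 13.2 (n = 3) and §8] -/
theorem torsionIso3_of_hesseCert_mk {W W' : WeierstrassCurve ℚ} [W.IsElliptic] [W'.IsElliptic]
    {a₁ a₂ a₃ a₄ a₆ a₁' a₂' a₃' a₄' a₆' : ℚ} (hW : W = ⟨a₁, a₂, a₃, a₄, a₆⟩)
    (hW' : W' = ⟨a₁', a₂', a₃', a₄', a₆'⟩) (c₄ c₆ c₄' c₆' : ℚ)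
    (hc₄ : (a₁ ^ 2 + 4 * a₂) ^ 2 - 24 * (2 * a₄ + a₁ * a₃) = c₄)
    (hc₆ : -(a₁ ^ 2 + 4 * a₂) ^ 3 + 36 * (a₁ ^ 2 + 4 * a₂) * (2 * a₄ + a₁ * a₃) - 216 * (a₃ ^ 2 + 4 * a₆)
      = c₆)
    (hc₄' : (a₁' ^ 2 + 4 * a₂') ^ 2 - 24 * (2 * a₄' + a₁' * a₃') = c₄')
    (hc₆' : -(a₁' ^ 2 + 4 * a₂') ^ 3 + 36 * (a₁' ^ 2 + 4 * a₂') * (2 * a₄' + a₁' * a₃')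
      - 216 * (a₃' ^ 2 + 4 * a₆') = c₆')
    (l m u : ℚ) (hu : u ≠ 0)
    (h4 : c₄ * l ^ 4 + 4 * c₆ * l ^ 3 * m + 6 * c₄ ^ 2 * l ^ 2 * m ^ 2 + 4 * c₄ * c₆ * l * m ^ 3
        + (4 * c₆ ^ 2 - 3 * c₄ ^ 3) * m ^ 4 = u ^ 4 * c₄')
    (h6 : c₆ * l ^ 6 + 6 * c₄ ^ 2 * l ^ 5 * m + 15 * c₄ * c₆ * l ^ 4 * m ^ 2 + 20 * c₆ ^ 2 * l ^ 3 * m ^ 3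
        + 15 * c₄ ^ 2 * c₆ * l ^ 2 * m ^ 4 + (18 * c₄ ^ 4 - 12 * c₄ * c₆ ^ 2) * l * m ^ 5
        + (9 * c₄ ^ 3 * c₆ - 8 * c₆ ^ 3) * m ^ 6 = u ^ 6 * c₆') :
    TorsionIso W' W 3 := by
  have e4 : W.c₄ = c₄ := by rw [hW, c₄_mk]; exact hc₄
  have e6 : W.c₆ = c₆ := by rw [hW, c₆_mk]; exact hc₆
  have e4' : W'.c₄ = c₄' := by rw [hW', c₄_mk]; exact hc₄'
  have e6' : W'.c₆ = c₆' := by rw [hW', c₆_mk]; exact hc₆'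
  exact threeCongruent_of_hesseCertificate_unconditional W W' l m u hu
    (by rw [eval_hesseC4three, e4, e6, e4']; exact h4) (by rw [eval_hesseC6three, e4, e6, e6']; exact h6)

/-- **Dual Hesse certificate for literal equations** (Fisher 2012 §13, the `X_E^-(3)` analogue of
Thm. 13.2, carried as the registered named fact `thm132rev_threeCongruent_dualHessePencil`, binder
`hF'`): with `Δ′ = c₄³ − c₆²`, the identities `−𝔇(l,m)/(4Δ′) = u⁴c₄'` and `−𝔠₆(l,m)/(8Δ′²) = u⁶c₆'`
(`Fisher2012.eval_hesseD3 / eval_hesseC6three`) give `TorsionIso W' W 3`.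
[cite: Fisher2012Hessian, §13 (analogue of Thm. 13.2 for X_E^-(3)) and §8] -/
theorem torsionIso3_of_dualHesseCert_mk (hF' : thm132rev_threeCongruent_dualHessePencil)
    {W W' : WeierstrassCurve ℚ} [W.IsElliptic] [W'.IsElliptic]
    {a₁ a₂ a₃ a₄ a₆ a₁' a₂' a₃' a₄' a₆' : ℚ} (hW : W = ⟨a₁, a₂, a₃, a₄, a₆⟩)
    (hW' : W' = ⟨a₁', a₂', a₃', a₄', a₆'⟩) (c₄ c₆ c₄' c₆' : ℚ)
    (hc₄ : (a₁ ^ 2 + 4 * a₂) ^ 2 - 24 * (2 * a₄ + a₁ * a₃) = c₄)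
    (hc₆ : -(a₁ ^ 2 + 4 * a₂) ^ 3 + 36 * (a₁ ^ 2 + 4 * a₂) * (2 * a₄ + a₁ * a₃) - 216 * (a₃ ^ 2 + 4 * a₆)
      = c₆)
    (hc₄' : (a₁' ^ 2 + 4 * a₂') ^ 2 - 24 * (2 * a₄' + a₁' * a₃') = c₄')
    (hc₆' : -(a₁' ^ 2 + 4 * a₂') ^ 3 + 36 * (a₁' ^ 2 + 4 * a₂') * (2 * a₄' + a₁' * a₃')
      - 216 * (a₃' ^ 2 + 4 * a₆') = c₆')
    (l m u : ℚ) (hu : u ≠ 0)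
    (h4 : -(l ^ 4 - 6 * c₄ * l ^ 2 * m ^ 2 - 8 * c₆ * l * m ^ 3 - 3 * c₄ ^ 2 * m ^ 4)
        / (4 * (c₄ ^ 3 - c₆ ^ 2)) = u ^ 4 * c₄')
    (h6 : -(c₆ * l ^ 6 + 6 * c₄ ^ 2 * l ^ 5 * m + 15 * c₄ * c₆ * l ^ 4 * m ^ 2 + 20 * c₆ ^ 2 * l ^ 3 * m ^ 3
        + 15 * c₄ ^ 2 * c₆ * l ^ 2 * m ^ 4 + (18 * c₄ ^ 4 - 12 * c₄ * c₆ ^ 2) * l * m ^ 5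
        + (9 * c₄ ^ 3 * c₆ - 8 * c₆ ^ 3) * m ^ 6) / (8 * (c₄ ^ 3 - c₆ ^ 2) ^ 2) = u ^ 6 * c₆') :
    TorsionIso W' W 3 := by
  have e4 : W.c₄ = c₄ := by rw [hW, c₄_mk]; exact hc₄
  have e6 : W.c₆ = c₆ := by rw [hW, c₆_mk]; exact hc₆
  have e4' : W'.c₄ = c₄' := by rw [hW', c₄_mk]; exact hc₄'
  have e6' : W'.c₆ = c₆' := by rw [hW', c₆_mk]; exact hc₆'
  exact threeCongruent_of_dualHesseCertificate hF' W W' l m u hu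
    (by rw [eval_hesseD3, e4, e6, e4']; exact h4) (by rw [eval_hesseC6three, e4, e6, e6']; exact h6)

end Summit.BirchSwinnertonDyer.Rank1Residual.GaloisImage.VisCerts
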